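import Summits.PneNP.PneNP.Theorems.SymmetryBudgetHamCompilesStubKotzigAux

/-!
# Stub `stub_kotzig` of line `kotzig-cutspan` (crux `SymmetryBudget.HamCompiles`,
stmt-PneNP-10637) — auxiliary file 2

Route `PneNP/SymmetryBudget`, crux `Summit.PneNP.PneNP.Theses.SymmetryBudget.HamCompiles`, line
`kotzig-cutspan`, stub `stub_kotzig` (`G.IsHamiltonian ↔ KotzigPred G F`).

This file is the purely combinatorial core of the backward direction: **Kotzig's theorem** on
alternating closed trails of a balanced connected two-coloured multigraph, in "transition system"
form.  Abstractly we are given two finite families of edges ("A-edges" indexed by `ιA`, "F-edges"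
indexed by `ιF`); every edge has two ends (half-edges `ι × Bool`, the other end of `h` being
`Prod.map id not h`), every half-edge carries a label in `L`.  A label-preserving bijection
`φ : ιF × Bool ≃ ιA × Bool` (a *transition system*) glues every F-half-edge to an A-half-edge of
the same label; "enter an A-edge at a dart, leave at its other end, jump along `φ⁻¹`, traverse the
F-edge, jump along `φ`" is a permutation `θ` of the darts `(ιA × Bool) ⊕ (ιF × Bool)`
(characterised by the two equations `hl`, `hr` below; no definition is introduced, `θ` and the
dart reversal `ε` are carried as variables with their defining equations) whose orbits are closed
trails alternating A- and F-edges.  If the labels are balanced (as many F- as A-half-edges at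
every label) and connected, some `φ` has an orbit passing every A-edge
(`exists_full_transition`): choose `φ` maximising the orbit of a fixed dart; if an edge is missed,
connectivity yields a visited and an unvisited half-edge with a common label, and re-gluing them
multiplies `θ` by two transpositions which merge two orbits into the orbit of the fixed dart — the
classical proof of Euler's theorem by splicing closed trails (A. Kotzig, *Moves without
forbidden transitions in a graph*, Mat. časopis 18 (1968) 76–80; H. Fleischner, *Eulerian Graphs
and Related Topics* I.1, Thm. VI.1).
-/

-- `Summit.PneNP.PneNP.…` duplicates `PneNP` BY DESIGN (single-problem summit, D-0017).
set_option linter.dupNamespace false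

namespace Summit.PneNP.PneNP.Theorems.HamCompilesKC

namespace KotzigTrail

open Equiv Equiv.Perm Finset

/-! ### Transition systems of a two-coloured system of edges -/

section Trail

variable {ιA ιF L : Type*}

/-- The dart reversal `ε` exists (as a permutation). -/
theorem exists_eps (ιA ιF : Type*) : ∃ ε : Perm ((ιA × Bool) ⊕ (ιF × Bool)),
    ∀ z, ε z = Sum.map (Prod.map id not) (Prod.map id not) z :=
  ⟨Equiv.sumCongr (Equiv.prodCongr (Equiv.refl ιA) Equiv.boolNot)
    (Equiv.prodCongr (Equiv.refl ιF) Equiv.boolNot), fun z => by cases z <;> rfl⟩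

/-- The trail permutation `θ_φ` of a transition system exists. -/
theorem exists_theta (φ : (ιF × Bool) ≃ (ιA × Bool)) : ∃ θ : Perm ((ιA × Bool) ⊕ (ιF × Bool)),
    (∀ h, θ (Sum.inl h) = Sum.inr (φ.symm (Prod.map id not h))) ∧
      (∀ f, θ (Sum.inr f) = Sum.inl (φ (Prod.map id not f))) :=
  ⟨((Equiv.sumComm (ιA × Bool) (ιF × Bool)).trans (Equiv.sumCongr φ φ.symm)) *
    Equiv.sumCongr (Equiv.prodCongr (Equiv.refl ιA) Equiv.boolNot)
      (Equiv.prodCongr (Equiv.refl ιF) Equiv.boolNot), fun _ => rfl, fun _ => rfl⟩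

variable {φ : (ιF × Bool) ≃ (ιA × Bool)} {ε θ : Perm ((ιA × Bool) ⊕ (ιF × Bool))}
  (hε : ∀ z, ε z = Sum.map (Prod.map id not) (Prod.map id not) z)
  (hl : ∀ h, θ (Sum.inl h) = Sum.inr (φ.symm (Prod.map id not h)))
  (hr : ∀ f, θ (Sum.inr f) = Sum.inl (φ (Prod.map id not f)))

include hl hr in
/-- `θ` is determined by its two equations: it is `γ_φ * ε` for the gluing involution `γ_φ`
(`inl h ↦ inr (φ⁻¹ h)`, `inr f ↦ inl (φ f)`) and the dart reversal `ε`. -/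
theorem theta_eq :
    θ = ((Equiv.sumComm (ιA × Bool) (ιF × Bool)).trans (Equiv.sumCongr φ φ.symm)) *
      Equiv.sumCongr (Equiv.prodCongr (Equiv.refl ιA) Equiv.boolNot)
        (Equiv.prodCongr (Equiv.refl ιF) Equiv.boolNot) := by
  ext z
  cases z with
  | inl h => rw [hl]; rfl
  | inr f => rw [hr]; rfl

include hl hr in
/-- No cycle of `θ` contains a dart and its reverse. -/
theorem not_sameCycle_flip [Fintype ιA] [Fintype ιF] (z : (ιA × Bool) ⊕ (ιF × Bool)) :
    ¬ θ.SameCycle z (Sum.map (Prod.map id not) (Prod.map id not) z) := by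
  obtain ⟨ε, hε⟩ := exists_eps ιA ιF
  rw [theta_eq hl hr, ← hε]
  have hεeq : ε = Equiv.sumCongr (Equiv.prodCongr (Equiv.refl ιA) Equiv.boolNot)
      (Equiv.prodCongr (Equiv.refl ιF) Equiv.boolNot) := by
    ext z
    rw [hε]
    cases z <;> rfl
  rw [← hεeq]
  refine not_sameCycle_rev (fun z => ?_) (fun z => ?_) (fun z => ?_) (fun z => ?_) z
  · cases z <;> simp
  · rw [hε, hε, sumMap_flipEnd_flipEnd]
  · cases z <;> simp
  · rw [hε]
    exact sumMap_flipEnd_ne z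

include hl hr in
/-- Dart reversal maps cycles of `θ` to cycles of `θ`. -/
theorem sameCycle_flip_iff (z w : (ιA × Bool) ⊕ (ιF × Bool)) :
    θ.SameCycle (Sum.map (Prod.map id not) (Prod.map id not) z)
      (Sum.map (Prod.map id not) (Prod.map id not) w) ↔ θ.SameCycle z w := by
  obtain ⟨ε, hε⟩ := exists_eps ιA ιF
  rw [theta_eq hl hr, ← hε, ← hε]
  have hεeq : ε = Equiv.sumCongr (Equiv.prodCongr (Equiv.refl ιA) Equiv.boolNot)
      (Equiv.prodCongr (Equiv.refl ιF) Equiv.boolNot) := by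
    ext z
    rw [hε]
    cases z <;> rfl
  rw [← hεeq]
  refine sameCycle_rev_iff (fun z => ?_) (fun z => ?_) z w
  · cases z <;> simp
  · rw [hε, hε, sumMap_flipEnd_flipEnd]

include hε hl hr in
/-- `θ ∘ ε ∘ θ = ε`. -/
theorem theta_eps_theta (z : (ιA × Bool) ⊕ (ιF × Bool)) : θ (ε (θ z)) = ε z := by
  cases z with
  | inl h => rw [hl, hε, Sum.map_inr, hr, flipEnd_flipEnd, Equiv.apply_symm_apply, hε, Sum.map_inl]
  | inr f => rw [hr, hε, Sum.map_inl, hl, flipEnd_flipEnd, Equiv.symm_apply_apply, hε, Sum.map_inr]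

include hr in
/-- `θ⁻¹` on A-darts. -/
theorem theta_symm_inl (x : ιA × Bool) :
    θ.symm (Sum.inl x) = Sum.inr (Prod.map id not (φ.symm x)) := by
  rw [Equiv.symm_apply_eq, hr, flipEnd_flipEnd, Equiv.apply_symm_apply]

/-! A dart `w` is *visited* by the trail of `z₀` if the trail passes its edge through `w` in
either direction: `w ∈ Vz` where `Vz` is carried as a variable with its defining equation `hV`. -/

variable {z₀ : (ιA × Bool) ⊕ (ιF × Bool)} {Vz : Set ((ιA × Bool) ⊕ (ιF × Bool))}
  (hV : ∀ w, w ∈ Vz ↔ θ.SameCycle z₀ w ∨ θ.SameCycle z₀ (ε w))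

include hε hV in
/-- Visiting is invariant under `ε`. -/
theorem vis_eps (w : (ιA × Bool) ⊕ (ιF × Bool)) : ε w ∈ Vz ↔ w ∈ Vz := by
  rw [hV, hV, hε, hε, sumMap_flipEnd_flipEnd]
  exact or_comm

include hε hl hr hV in
/-- Visiting is invariant under `θ`. -/
theorem vis_theta {w : (ιA × Bool) ⊕ (ιF × Bool)} (h : w ∈ Vz) : θ w ∈ Vz := by
  rw [hV] at h ⊢
  rcases h with h | h
  · exact Or.inl (sameCycle_apply_right.2 h)
  · right
    have : ε (θ w) = θ.symm (ε w) := by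
      rw [Equiv.eq_symm_apply]
      exact theta_eps_theta hε hl hr w
    rw [this]
    exact sameCycle_symm_apply_right.2 h

include hε hl hr hV in
/-- Visiting is invariant under the gluing `inl h ↦ inr (φ⁻¹ h)`. -/
theorem vis_glue_inl {h : ιA × Bool} (hv : (Sum.inl h : (ιA × Bool) ⊕ (ιF × Bool)) ∈ Vz) :
    (Sum.inr (φ.symm h) : (ιA × Bool) ⊕ (ιF × Bool)) ∈ Vz := by
  have e : (Sum.inr (φ.symm h) : (ιA × Bool) ⊕ (ιF × Bool)) = θ (ε (Sum.inl h)) := by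
    rw [hε, Sum.map_inl, hl, flipEnd_flipEnd]
  rw [e]
  exact vis_theta hε hl hr hV ((vis_eps hε hV _).2 hv)

include hε hl hr hV in
/-- Visiting is invariant under the gluing `inr f ↦ inl (φ f)`. -/
theorem vis_glue_inr {f : ιF × Bool} (hv : (Sum.inr f : (ιA × Bool) ⊕ (ιF × Bool)) ∈ Vz) :
    (Sum.inl (φ f) : (ιA × Bool) ⊕ (ιF × Bool)) ∈ Vz := by
  have e : (Sum.inl (φ f) : (ιA × Bool) ⊕ (ιF × Bool)) = θ (ε (Sum.inr f)) := by
    rw [hε, Sum.map_inr, hr, flipEnd_flipEnd]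
  rw [e]
  exact vis_theta hε hl hr hV ((vis_eps hε hV _).2 hv)

include hε hl hr hV in
/-- Visiting is constant on cycles of `θ`. -/
theorem vis_congr [Fintype ιA] [Fintype ιF] {w w' : (ιA × Bool) ⊕ (ιF × Bool)}
    (h : θ.SameCycle w w') : w ∈ Vz ↔ w' ∈ Vz := by
  rw [hV, hV, hε, hε]
  have h' := (sameCycle_flip_iff hl hr w w').2 h
  exact or_congr ⟨fun k => k.trans h, fun k => k.trans h.symm⟩
    ⟨fun k => k.trans h', fun k => k.trans h'.symm⟩

/-- A transposition of A-darts acts on A-darts. -/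
theorem swap_inl_inl [DecidableEq ιA] [DecidableEq ιF] (a b h : ιA × Bool) :
    swap (Sum.inl a : (ιA × Bool) ⊕ (ιF × Bool)) (Sum.inl b) (Sum.inl h) = Sum.inl (swap a b h) :=
  (Sum.inl_injective.map_swap a b h).symm

/-- A transposition of F-darts acts on F-darts. -/
theorem swap_inr_inr [DecidableEq ιA] [DecidableEq ιF] (a b f : ιF × Bool) :
    swap (Sum.inr a : (ιA × Bool) ⊕ (ιF × Bool)) (Sum.inr b) (Sum.inr f) = Sum.inr (swap a b f) :=
  (Sum.inr_injective.map_swap a b f).symm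

include hl hr in
/-- Re-gluing two A-half-edges `x`, `y`: the trail permutation of `φ.trans (swap x y)` is the
old one multiplied by two transpositions. -/
theorem theta_trans_swap [DecidableEq ιA] [DecidableEq ιF] (x y : ιA × Bool)
    {θ' : Perm ((ιA × Bool) ⊕ (ιF × Bool))}
    (hl' : ∀ h, θ' (Sum.inl h) = Sum.inr ((φ.trans (swap x y)).symm (Prod.map id not h)))
    (hr' : ∀ f, θ' (Sum.inr f) = Sum.inl ((φ.trans (swap x y)) (Prod.map id not f))) :
    θ' = θ * swap (Sum.inr (Prod.map id not (φ.symm x))) (Sum.inr (Prod.map id not (φ.symm y))) *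
        swap (Sum.inl (Prod.map id not x)) (Sum.inl (Prod.map id not y)) := by
  ext z
  cases z with
  | inl h =>
    rw [Perm.mul_apply, Perm.mul_apply, swap_inl_inl,
      swap_apply_of_ne_of_ne Sum.inl_ne_inr Sum.inl_ne_inr, hl', hl,
      Equiv.symm_trans_apply, Equiv.symm_swap, flipEnd_swap, flipEnd_flipEnd, flipEnd_flipEnd]
  | inr f =>
    rw [Perm.mul_apply, Perm.mul_apply, swap_apply_of_ne_of_ne Sum.inr_ne_inl Sum.inr_ne_inl,
      swap_inr_inr, hr', hr, Equiv.trans_apply, flipEnd_swap, flipEnd_flipEnd,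
      flipEnd_flipEnd, φ.injective.map_swap, Equiv.apply_symm_apply, Equiv.apply_symm_apply]

end Trail

/-! ### Balanced connected systems have a full transition system -/

section Full

variable {ιA ιF L : Type*} [Fintype ιA] [Fintype ιF] [DecidableEq ιA] [DecidableEq ιF]
  [DecidableEq L] {la : ιA × Bool → L} {lf : ιF × Bool → L}

omit [DecidableEq ιA] [DecidableEq ιF] in
/-- Balanced labels admit a transition system (glue fibre by fibre). -/
theorem exists_lpb
    (hbal : ∀ i, (univ.filter fun f => lf f = i).card = (univ.filter fun h => la h = i).card) :
    ∃ φ : (ιF × Bool) ≃ (ιA × Bool), ∀ f, la (φ f) = lf f := by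
  have e : ∀ i, {f // lf f = i} ≃ {h // la h = i} := fun i =>
    Fintype.equivOfCardEq (by rw [Fintype.card_subtype, Fintype.card_subtype]; exact hbal i)
  exact ⟨Equiv.ofFiberEquiv e, fun f => Equiv.ofFiberEquiv_map e f⟩

omit [Fintype ιA] [Fintype ιF] [DecidableEq ιA] [DecidableEq ιF] [DecidableEq L] in
/-- If some A-dart is not visited, connectivity of the labels gives a visited and an unvisited
A-dart with a common label. -/
theorem exists_vis_not_vis {φ : (ιF × Bool) ≃ (ιA × Bool)} (hφ : ∀ f, la (φ f) = lf f)
    {ε θ : Perm ((ιA × Bool) ⊕ (ιF × Bool))}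
    (hε : ∀ z, ε z = Sum.map (Prod.map id not) (Prod.map id not) z)
    (hl : ∀ h, θ (Sum.inl h) = Sum.inr (φ.symm (Prod.map id not h)))
    (hr : ∀ f, θ (Sum.inr f) = Sum.inl (φ (Prod.map id not f))) (h₀ : ιA × Bool)
    {Vz : Set ((ιA × Bool) ⊕ (ιF × Bool))}
    (hV : ∀ w, w ∈ Vz ↔ θ.SameCycle (Sum.inl h₀) w ∨ θ.SameCycle (Sum.inl h₀) (ε w))
    (hconn : ∀ P : L → Prop, P (la h₀) → (∀ h, P (la h) → P (la (Prod.map id not h))) →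
      (∀ f, P (lf f) → P (lf (Prod.map id not f))) → ∀ h, P (la h))
    {y : ιA × Bool} (hy : (Sum.inl y : (ιA × Bool) ⊕ (ιF × Bool)) ∉ Vz) :
    ∃ x y' : ιA × Bool, la x = la y' ∧ (Sum.inl x : (ιA × Bool) ⊕ (ιF × Bool)) ∈ Vz ∧
      (Sum.inl y' : (ιA × Bool) ⊕ (ιF × Bool)) ∉ Vz := by
  by_contra hne
  push Not at hne
  apply hy
  have key := hconn (fun i => ∃ x, (Sum.inl x : (ιA × Bool) ⊕ (ιF × Bool)) ∈ Vz ∧ la x = i)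
    ⟨h₀, (hV _).2 (Or.inl (SameCycle.refl _ _)), rfl⟩ ?_ ?_ y
  · obtain ⟨x, hx, hxy⟩ := key
    exact hne x y hxy hx
  · rintro h ⟨x, hx, hxh⟩
    have h1 : (Sum.inl h : (ιA × Bool) ⊕ (ιF × Bool)) ∈ Vz := hne x h hxh hx
    refine ⟨Prod.map id not h, ?_, rfl⟩
    have := (vis_eps hε hV (Sum.inl h)).2 h1
    rwa [hε, Sum.map_inl] at this
  · rintro f ⟨x, hx, hxf⟩
    have h1 : (Sum.inl (φ f) : (ιA × Bool) ⊕ (ιF × Bool)) ∈ Vz :=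
      hne x (φ f) (by rw [hφ f]; exact hxf) hx
    have h2 : (Sum.inr f : (ιA × Bool) ⊕ (ιF × Bool)) ∈ Vz := by
      have := vis_glue_inl hε hl hr hV h1
      rwa [Equiv.symm_apply_apply] at this
    have h3 : (Sum.inl (φ (Prod.map id not f)) : (ιA × Bool) ⊕ (ιF × Bool)) ∈ Vz := by
      have := (vis_eps hε hV (Sum.inr f)).2 h2
      rw [hε, Sum.map_inr] at this
      exact vis_glue_inr hε hl hr hV this
    exact ⟨φ (Prod.map id not f), h3, hφ _⟩

/-- **Kotzig's theorem (transition-system form).** If the labels are balanced and connected, some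
transition system `φ` has a trail (the orbit of `inl h₀` under its trail permutation `θ`) passing
every A-edge. -/
theorem exists_full_transition (la : ιA × Bool → L) (lf : ιF × Bool → L) (h₀ : ιA × Bool)
    (hbal : ∀ i, (univ.filter fun f => lf f = i).card = (univ.filter fun h => la h = i).card)
    (hconn : ∀ P : L → Prop, P (la h₀) → (∀ h, P (la h) → P (la (Prod.map id not h))) →
      (∀ f, P (lf f) → P (lf (Prod.map id not f))) → ∀ h, P (la h)) :
    ∃ (φ : (ιF × Bool) ≃ (ιA × Bool)) (θ : Perm ((ιA × Bool) ⊕ (ιF × Bool))),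
      (∀ f, la (φ f) = lf f) ∧ (∀ h, θ (Sum.inl h) = Sum.inr (φ.symm (Prod.map id not h))) ∧
      (∀ f, θ (Sum.inr f) = Sum.inl (φ (Prod.map id not f))) ∧
      ∀ h : ιA × Bool, θ.SameCycle (Sum.inl h₀) (Sum.inl h) ∨
        θ.SameCycle (Sum.inl h₀) (Sum.inl (Prod.map id not h)) := by
  obtain ⟨ε, hε⟩ := exists_eps ιA ιF
  haveI : Nonempty {φ : (ιF × Bool) ≃ (ιA × Bool) // ∀ f, la (φ f) = lf f} :=
    let ⟨φ, hφ⟩ := exists_lpb hbal; ⟨⟨φ, hφ⟩⟩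
  set z₀ : (ιA × Bool) ⊕ (ιF × Bool) := Sum.inl h₀ with hz₀
  -- the trail permutation of a transition system, chosen through `exists_theta`
  set Θ : {φ : (ιF × Bool) ≃ (ιA × Bool) // ∀ f, la (φ f) = lf f} →
      Perm ((ιA × Bool) ⊕ (ιF × Bool)) := fun φ => Classical.choose (exists_theta φ.1) with hΘ
  have hΘl : ∀ φ h, Θ φ (Sum.inl h) = Sum.inr (φ.1.symm (Prod.map id not h)) := fun φ =>
    (Classical.choose_spec (exists_theta φ.1)).1
  have hΘr : ∀ φ f, Θ φ (Sum.inr f) = Sum.inl (φ.1 (Prod.map id not f)) := fun φ =>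
    (Classical.choose_spec (exists_theta φ.1)).2
  set μ : {φ : (ιF × Bool) ≃ (ιA × Bool) // ∀ f, la (φ f) = lf f} → ℕ := fun φ =>
    (univ.filter fun w => (Θ φ).SameCycle z₀ w).card with hμ
  obtain ⟨φ, -, hmax⟩ := exists_max_image univ μ univ_nonempty
  refine ⟨φ.1, Θ φ, φ.2, hΘl φ, hΘr φ, ?_⟩
  by_contra hall
  push Not at hall
  obtain ⟨y₀, hy₀⟩ := hall
  set θ := Θ φ with hθ
  set Vz : Set ((ιA × Bool) ⊕ (ιF × Bool)) := {w | θ.SameCycle z₀ w ∨ θ.SameCycle z₀ (ε w)}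
    with hVz
  have hV : ∀ w, w ∈ Vz ↔ θ.SameCycle z₀ w ∨ θ.SameCycle z₀ (ε w) := fun w => Iff.rfl
  have hy₀' : (Sum.inl y₀ : (ιA × Bool) ⊕ (ιF × Bool)) ∉ Vz := by
    rw [hV, hε, Sum.map_inl]
    exact not_or.2 hy₀
  obtain ⟨x, y, hxy, hx, hy⟩ :=
    exists_vis_not_vis φ.2 hε (hΘl φ) (hΘr φ) h₀ hV hconn hy₀'
  let φ' : {φ : (ιF × Bool) ≃ (ιA × Bool) // ∀ f, la (φ f) = lf f} :=
    ⟨φ.1.trans (swap x y), fun f => by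
      change la (swap x y (φ.1 f)) = lf f
      rw [swap_apply_def]
      split_ifs with h1 h2
      · rw [← hxy, ← h1, φ.2]
      · rw [hxy, ← h2, φ.2]
      · exact φ.2 f⟩
  suffices hlt : μ φ < μ φ' from absurd (hmax φ' (mem_univ _)) (not_le.2 hlt)
  have hNSR : ∀ z, ¬ θ.SameCycle z (ε z) := fun z => by
    rw [hε]
    exact not_sameCycle_flip (hΘl φ) (hΘr φ) z
  set a₁ : (ιA × Bool) ⊕ (ιF × Bool) := Sum.inl (Prod.map id not x) with ha₁
  set b₁ : (ιA × Bool) ⊕ (ιF × Bool) := Sum.inl (Prod.map id not y) with hb₁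
  set a₂ : (ιA × Bool) ⊕ (ιF × Bool) := Sum.inr (Prod.map id not (φ.1.symm x)) with ha₂'
  set b₂ : (ιA × Bool) ⊕ (ιF × Bool) := Sum.inr (Prod.map id not (φ.1.symm y)) with hb₂'
  have ha₂ : θ.SameCycle a₂ (Sum.inl x) :=
    ⟨1, by rw [zpow_one, ha₂', hΘr, flipEnd_flipEnd, Equiv.apply_symm_apply]⟩
  have hb₂ : θ.SameCycle b₂ (Sum.inl y) :=
    ⟨1, by rw [zpow_one, hb₂', hΘr, flipEnd_flipEnd, Equiv.apply_symm_apply]⟩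
  have hea₁ : a₁ = ε (Sum.inl x) := by rw [hε, Sum.map_inl]
  have heb₁ : b₁ = ε (Sum.inl y) := by rw [hε, Sum.map_inl]
  have hy' : ¬ θ.SameCycle z₀ (Sum.inl y) ∧ ¬ θ.SameCycle z₀ b₁ := by
    have := hy
    rw [hV, ← heb₁] at this
    exact not_or.1 this
  have vtrans : ∀ {w w'}, θ.SameCycle w w' → w ∈ Vz → w' ∈ Vz :=
    fun h hw => (vis_congr hε (hΘl φ) (hΘr φ) hV h).1 hw
  have hexV : a₁ ∈ Vz := hea₁ ▸ (vis_eps hε hV _).2 hx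
  have heyV : b₁ ∉ Vz := fun h => hy ((vis_eps hε hV _).1 (heb₁ ▸ h))
  have n22 : ¬ θ.SameCycle a₂ b₂ := fun h => hy (vtrans (ha₂.symm.trans (h.trans hb₂)) hx)
  have n21 : ¬ θ.SameCycle a₂ a₁ := fun h => hNSR (Sum.inl x) (hea₁ ▸ ha₂.symm.trans h)
  have nb2a1 : ¬ θ.SameCycle b₂ a₁ := fun h => hy (vtrans (hb₂.symm.trans h).symm hexV)
  have na2b1 : ¬ θ.SameCycle a₂ b₁ := fun h => heyV (vtrans (ha₂.symm.trans h) hx)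
  have nb2b1 : ¬ θ.SameCycle b₂ b₁ := fun h => hNSR (Sum.inl y) (heb₁ ▸ hb₂.symm.trans h)
  have n11 : ¬ θ.SameCycle a₁ b₁ := fun h => heyV (vtrans h hexV)
  have hθ' : Θ φ' = θ * swap a₂ b₂ * swap a₁ b₁ :=
    theta_trans_swap (hΘl φ) (hΘr φ) x y (hΘl φ') (hΘr φ')
  have key : ∃ w₁, ¬ θ.SameCycle z₀ w₁ ∧
      ∀ w, (Θ φ').SameCycle z₀ w ↔ θ.SameCycle z₀ w ∨ θ.SameCycle w₁ w := by
    have hx' := hx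
    rw [hV, ← hea₁] at hx'
    rcases hx' with hxA | hxB
    · refine ⟨b₂, fun h => hy'.1 (h.trans hb₂), fun w => ?_⟩
      rw [hθ']
      exact sameCycle_mul_swap_mul_swap_iff θ n22 n21 nb2a1 na2b1 nb2b1 (hxA.trans ha₂.symm) w
    · refine ⟨b₁, hy'.2, fun w => ?_⟩
      rw [hθ', mul_assoc, swap_mul_swap_comm_of_ne Sum.inr_ne_inl Sum.inr_ne_inl Sum.inr_ne_inl
        Sum.inr_ne_inl, ← mul_assoc]
      exact sameCycle_mul_swap_mul_swap_iff θ n11 (fun h => n21 h.symm) (fun h => na2b1 h.symm)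
        (fun h => nb2a1 h.symm) (fun h => nb2b1 h.symm) hxB w
  obtain ⟨w₁, hw₁, hiff⟩ := key
  apply Finset.card_lt_card
  refine (Finset.ssubset_iff_of_subset fun w hw => ?_).2 ⟨w₁, ?_, ?_⟩
  · simp only [mem_filter, mem_univ, true_and] at hw ⊢
    exact (hiff w).2 (Or.inl hw)
  · simp only [mem_filter, mem_univ, true_and]
    exact (hiff w₁).2 (Or.inr (SameCycle.refl _ _))
  · simp only [mem_filter, mem_univ, true_and]
    exact hw₁

end Full

end KotzigTrail

/-- Registered sub-goal of `stub_kotzig` served by this file (`--supports stmt-PneNP-10637`):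
Kotzig's theorem in transition-system form, `KotzigTrail.exists_full_transition`. -/
theorem stub_kotzig_transition {ιA ιF L : Type*} [Fintype ιA] [Fintype ιF] [DecidableEq ιA]
    [DecidableEq ιF] [DecidableEq L] (la : ιA × Bool → L) (lf : ιF × Bool → L) (h₀ : ιA × Bool)
    (hbal : ∀ i, (Finset.univ.filter fun f => lf f = i).card =
      (Finset.univ.filter fun h => la h = i).card)
    (hconn : ∀ P : L → Prop, P (la h₀) → (∀ h, P (la h) → P (la (Prod.map id not h))) →
      (∀ f, P (lf f) → P (lf (Prod.map id not f))) → ∀ h, P (la h)) :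
    ∃ (φ : (ιF × Bool) ≃ (ιA × Bool)) (θ : Equiv.Perm ((ιA × Bool) ⊕ (ιF × Bool))),
      (∀ f, la (φ f) = lf f) ∧ (∀ h, θ (Sum.inl h) = Sum.inr (φ.symm (Prod.map id not h))) ∧
      (∀ f, θ (Sum.inr f) = Sum.inl (φ (Prod.map id not f))) ∧
      ∀ h : ιA × Bool, θ.SameCycle (Sum.inl h₀) (Sum.inl h) ∨
        θ.SameCycle (Sum.inl h₀) (Sum.inl (Prod.map id not h)) :=
  KotzigTrail.exists_full_transition la lf h₀ hbal hconn

end Summit.PneNP.PneNP.Theorems.HamCompilesKC
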